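import Summits.ValiantsHypothesis.ValiantsHypothesis.Theorems.ProjectionStabilityOptStepTwoSidedTorusWeights
import Literature.Computability.AlgebraicComplexity.LRWeightCount
import HarnessLib

/-!
# Two-sided-torus lower bound for `per_m` — II: the top weight and the chain for GENERAL multipliers

Support file for crux `ProjectionStability.OptStep` (stmt-ValiantsHypothesis-17835), line `Sketch`,
stub K2 `stub_twoSidedTorus_lower`.  Continues
`ProjectionStabilityOptStepTwoSidedTorusWeights.lean` (weights of the canonical subspaces `𝒫_S` of a
pencil `Λ + Σ x_{kj} A_{kj}` with ONE exact lift `L` of a torus element with arbitrary multipliers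
`r` and an abstract injective weight function `wt`), re-proving for this setting the parts of the
tree's `LRWeightCount.lean` (LR17 §6) that do NOT use permutation lifts:

* `exists_top`: if `ker Λ` is a line, all weight spaces but one (`β_top`) lie in `range Λ`;
* `exists_wt_of_not_le_range`, `wt_eq_of_not_le_range`: a canonical subspace escaping `range Λ`
  does so through a weight piece, whose weight is `β_top`;
* the chain `exists_good_of_le_card_of_le`: from a GOOD exponent `u` (`u ≠ 0` and `wt u` a weight
  of `𝒫_{[m]}`) one descends to good exponents `v ≤ u` of every support size `1 ≤ s ≤ |supp u|`
  (the tree's `exists_good_of_le_card`, with the extra bookkeeping `v ≤ u`).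

The full-support statement for the top exponent and the count are NOT taken from the tree (there
they use the lifts of transpositions / of all permutations); K2 replaces them by a swap argument
across the restricted pencils and a covering count (next file).

## References
* J. M. Landsberg, N. Ressayre, arXiv:1508.05788, §6 (method).
* Tree: `Literature/Computability/AlgebraicComplexity/LRWeightCount.lean`.
-/

noncomputable section

set_option linter.dupNamespace false

namespace Summit.ValiantsHypothesis.ValiantsHypothesis.Theorems.ProjectionStabilityOptStep.GenTorus

open Submodule Module.End Finset
open Literature.Computability.AlgebraicComplexity LRPencil

variable {V : Type*} [AddCommGroup V] [Module ℂ V] {m : ℕ}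
variable {Λ : Module.End ℂ V} {A : Fin m → Fin m → Module.End ℂ V} {r : Fin m → ℂ}
variable (L : Lift Λ A 1 r) (wt : (Fin m → ℕ) → ℂ)


/-! ### The top weight -/

/-- If `B ≡ β_top` modulo a `B`-stable `H`, then `(B - β)^N ≡ (β_top - β)^N` modulo `H`. [folklore] -/
theorem pow_sub_apply_sub_mem {H : Submodule ℂ V} {βt : ℂ} (hβt : ∀ v, (L.B : V →ₗ[ℂ] V) v - βt • v ∈ H)
    (β : ℂ) (N : ℕ) (v : V) :
    (((L.B : V →ₗ[ℂ] V) - β • (1 : Module.End ℂ V)) ^ N) v - (βt - β) ^ N • v ∈ H := by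
  induction N with
  | zero => simp
  | succ N ih =>
    rw [pow_succ', Module.End.mul_apply, pow_succ', mul_smul]
    set w := (((L.B : V →ₗ[ℂ] V) - β • (1 : Module.End ℂ V)) ^ N) v
    have : ((L.B : V →ₗ[ℂ] V) - β • (1 : Module.End ℂ V)) w - (βt - β) • ((βt - β) ^ N • v) =
        ((L.B : V →ₗ[ℂ] V) w - βt • w) + (βt - β) • (w - (βt - β) ^ N • v) := by
      simp only [LinearMap.sub_apply, LinearMap.smul_apply, Module.End.one_apply]
      module
    rw [this]
    exact H.add_mem (hβt w) (H.smul_mem _ ih)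

variable [FiniteDimensional ℂ V]

/-- **The top weight**: if `ker Λ` is a line, then `range Λ` is a `B`-stable hyperplane and every
weight space `E β` with `β ≠ β_top` lies in `range Λ`. [cite: LandsbergRessayre2017, §6] -/
theorem exists_top (hK : Module.finrank ℂ (LinearMap.ker Λ) = 1) :
    ∃ βt : ℂ, ∀ β, β ≠ βt → (maxGenEigenspace (L.B : V →ₗ[ℂ] V)) β ≤ LinearMap.range Λ := by
  set H := LinearMap.range Λ with hHdef
  have hBH : H.map (L.B : V →ₗ[ℂ] V) ≤ H := (L.map_range_eq).le
  have hdim : Module.finrank ℂ H + 1 = Module.finrank ℂ V := by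
    have := LinearMap.finrank_range_add_finrank_ker Λ
    rw [hK] at this; exact this
  have hHtop : H ≠ ⊤ := by
    intro h; rw [h, finrank_top] at hdim; omega
  obtain ⟨v₁, -, hv₁⟩ := SetLike.exists_of_lt (lt_top_iff_ne_top.2 hHtop)
  have hsup : H ⊔ (ℂ ∙ v₁) = ⊤ := by
    apply Submodule.eq_top_of_finrank_eq
    apply le_antisymm (Submodule.finrank_le _)
    have hlt : H < H ⊔ (ℂ ∙ v₁) := by
      refine lt_of_le_of_ne le_sup_left fun h => hv₁ ?_
      rw [h]; exact Submodule.mem_sup_right (Submodule.mem_span_singleton_self v₁)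
    have := Submodule.finrank_lt_finrank_of_lt hlt
    omega
  have hdec : ∀ v : V, ∃ h ∈ H, ∃ a : ℂ, v = h + a • v₁ := fun v => by
    have hv : v ∈ H ⊔ (ℂ ∙ v₁) := by rw [hsup]; exact Submodule.mem_top
    obtain ⟨h, hh, z, hz, rfl⟩ := Submodule.mem_sup.1 hv
    obtain ⟨a, rfl⟩ := Submodule.mem_span_singleton.1 hz
    exact ⟨h, hh, a, rfl⟩
  obtain ⟨h₁, hh₁, βt, hB₁⟩ := hdec ((L.B : V →ₗ[ℂ] V) v₁)
  refine ⟨βt, fun β hβ => ?_⟩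
  have hall : ∀ v, (L.B : V →ₗ[ℂ] V) v - βt • v ∈ H := fun v => by
    obtain ⟨h, hh, a, rfl⟩ := hdec v
    have : (L.B : V →ₗ[ℂ] V) (h + a • v₁) - βt • (h + a • v₁) = ((L.B : V →ₗ[ℂ] V) h - βt • h) + a • h₁ := by
      rw [map_add, map_smul, hB₁]; module
    rw [this]
    exact H.add_mem (H.sub_mem (hBH (Submodule.mem_map_of_mem hh)) (H.smul_mem _ hh))
      (H.smul_mem _ hh₁)
  intro v hv
  obtain ⟨N, hN⟩ := (Module.End.mem_maxGenEigenspace _ _ _).1 hv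
  have key := pow_sub_apply_sub_mem L hall β N v
  rw [hN, zero_sub, neg_mem_iff] at key
  exact (Submodule.smul_mem_iff H (pow_ne_zero N (sub_ne_zero.2 (Ne.symm hβ)))).1 key

omit [FiniteDimensional ℂ V] in
/-- The top weight is unique as soon as SOME weight space escapes `range Λ`. [folklore] -/
theorem top_unique {βt βt' : ℂ} (hβt : ∀ β, β ≠ βt → (maxGenEigenspace (L.B : V →ₗ[ℂ] V)) β ≤ LinearMap.range Λ)
    (hβt' : ∀ β, β ≠ βt' → (maxGenEigenspace (L.B : V →ₗ[ℂ] V)) β ≤ LinearMap.range Λ) {β₀ : ℂ}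
    (h : ¬ (maxGenEigenspace (L.B : V →ₗ[ℂ] V)) β₀ ≤ LinearMap.range Λ) : βt = βt' := by
  have h1 : β₀ = βt := by by_contra hne; exact h (hβt _ hne)
  have h2 : β₀ = βt' := by by_contra hne; exact h (hβt' _ hne)
  rw [← h1, ← h2]

/-! ### Escape through a weight piece -/

/-- If `𝒫_S ⊄ range Λ` then some weight piece of `𝒫_S` is `⊄ range Λ`. [cite: LandsbergRessayre2017, §6] -/
theorem exists_wt_of_not_le_range (hinj : Function.Injective wt)
    (hstep : ∀ (u : Fin m → ℕ) (k : Fin m), wt (u + Pi.single k 1) = r k * wt u)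
    (hker : LinearMap.ker Λ ≤ (maxGenEigenspace (L.C : V →ₗ[ℂ] V)) (wt 0)) {S : Finset (Fin m)}
    (h : ¬ canon Λ A S ≤ LinearMap.range Λ) :
    ∃ u ∈ U S, ¬ canon Λ A S ⊓ (maxGenEigenspace (L.B : V →ₗ[ℂ] V)) (wt u) ≤ LinearMap.range Λ := by
  by_contra hall
  push Not at hall
  exact h ((canon_le_iSup_inf L wt hinj hstep hker S).trans (iSup_le fun u => hall u u.2))

omit [FiniteDimensional ℂ V] in
/-- A weight piece `⊄ range Λ` has the top weight. [cite: LandsbergRessayre2017, §6] -/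
theorem wt_eq_of_not_le_range {βt : ℂ} (hβt : ∀ β, β ≠ βt → (maxGenEigenspace (L.B : V →ₗ[ℂ] V)) β ≤ LinearMap.range Λ)
    {P : Submodule ℂ V} {u : Fin m → ℕ} (h : ¬ P ⊓ (maxGenEigenspace (L.B : V →ₗ[ℂ] V)) (wt u) ≤ LinearMap.range Λ) :
    wt u = βt := by
  by_contra hne
  exact h (inf_le_right.trans (hβt _ hne))

/-! ### The chain: good exponents of every support size -/

/-- One descent step preserves goodness: a good `u` (`u ∈ U [m]`, `wt u` a weight of `𝒫_{[m]}`)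
with `|supp u| ≥ 2` comes from a good `u' = u - e_k`. [cite: LandsbergRessayre2017, §6] -/
theorem exists_good_pred (hinj : Function.Injective wt)
    (hstep : ∀ (u : Fin m → ℕ) (k : Fin m), wt (u + Pi.single k 1) = r k * wt u)
    (hker : LinearMap.ker Λ ≤ (maxGenEigenspace (L.C : V →ₗ[ℂ] V)) (wt 0)) {u : Fin m → ℕ}
    (hu : u ∈ U univ ∧ canon Λ A univ ⊓ (maxGenEigenspace (L.B : V →ₗ[ℂ] V)) (wt u) ≠ ⊥) (h2 : 2 ≤ (supp u).card) :
    ∃ k u', u = u' + Pi.single k 1 ∧ (u' ∈ U univ ∧ canon Λ A univ ⊓ (maxGenEigenspace (L.B : V →ₗ[ℂ] V)) (wt u') ≠ ⊥) := by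
  have hu1 : ∀ k, u ≠ 0 + Pi.single k 1 := by
    intro k hk; rw [hk, TorusData.supp_single, card_singleton] at h2; omega
  obtain ⟨k, -, u', hu', rfl, hne⟩ :=
    exists_pred_of_canon_inf_wt_ne_bot L wt hinj hstep hker hu1 hu.2
  exact ⟨k, u', rfl, hu', fun h => hne (by rw [h, bot_inf_eq])⟩

/-- **The chain** (LR17 §6, descending one row at a time): from a good `u` one reaches good
exponents `v ≤ u` of every support size `1 ≤ s ≤ |supp u|`. [cite: LandsbergRessayre2017, §6] -/
theorem exists_good_of_le_card_of_le (hinj : Function.Injective wt)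
    (hstep : ∀ (u : Fin m → ℕ) (k : Fin m), wt (u + Pi.single k 1) = r k * wt u)
    (hker : LinearMap.ker Λ ≤ (maxGenEigenspace (L.C : V →ₗ[ℂ] V)) (wt 0)) (n : ℕ) :
    ∀ u : Fin m → ℕ, ∑ i, u i = n → (u ∈ U univ ∧ canon Λ A univ ⊓ (maxGenEigenspace (L.B : V →ₗ[ℂ] V)) (wt u) ≠ ⊥) →
    ∀ s, 1 ≤ s → s ≤ (supp u).card →
      ∃ v, v ≤ u ∧ (v ∈ U univ ∧ canon Λ A univ ⊓ (maxGenEigenspace (L.B : V →ₗ[ℂ] V)) (wt v) ≠ ⊥) ∧ (supp v).card = s := by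
  induction n with
  | zero =>
    intro u hu _ s hs1 hs
    have : u = 0 := funext fun i => (sum_eq_zero_iff.1 hu) i (mem_univ i)
    rw [(supp_eq_empty_iff u).2 this, card_empty] at hs
    omega
  | succ n ih =>
    intro u hu hgood s hs1 hs
    by_cases hsc : s = (supp u).card
    · exact ⟨u, le_rfl, hgood, hsc.symm⟩
    · have h2 : 2 ≤ (supp u).card := by omega
      obtain ⟨k, u', rfl, hgood'⟩ := exists_good_pred L wt hinj hstep hker hgood h2
      have hsum : ∑ i, u' i = n := by rw [TorusData.sum_add_single] at hu; omega
      have hcard : s ≤ (supp u').card := by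
        rw [supp_add_single] at hs
        have := card_insert_le k (supp u')
        rw [supp_add_single] at hsc
        omega
      obtain ⟨v, hvle, hv, hvs⟩ := ih u' hsum hgood' s hs1 hcard
      exact ⟨v, hvle.trans fun i => by simp only [Pi.add_apply]; exact Nat.le_add_right _ _, hv, hvs⟩

end Summit.ValiantsHypothesis.ValiantsHypothesis.Theorems.ProjectionStabilityOptStep.GenTorus

namespace Summit.ValiantsHypothesis.ValiantsHypothesis.Theorems.ProjectionStabilityOptStep.GenTorus

open Literature.Computability.AlgebraicComplexity

/-! ### Export (registered helper stub of stmt-ValiantsHypothesis-17835) -/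

/-- **The chain, closed form** (all data explicit; this is the registered helper stub
`stub_genTorus_chain` of the crux item, = `exists_good_of_le_card_of_le`). [cite: LandsbergRessayre2017, §6] -/
theorem stub_genTorus_chain : ∀ {V : Type} [AddCommGroup V] [Module ℂ V] [FiniteDimensional ℂ V] {m : ℕ} {Λ : Module.End ℂ V} {A : Fin m → Fin m → Module.End ℂ V} {r : Fin m → ℂ} (L : LRPencil.Lift Λ A 1 r) (wt : (Fin m → ℕ) → ℂ), Function.Injective wt → (∀ (u : Fin m → ℕ) (k : Fin m), wt (u + Pi.single k 1) = r k * wt u) → LinearMap.ker Λ ≤ Module.End.maxGenEigenspace (L.C : V →ₗ[ℂ] V) (wt 0) → ∀ (u : Fin m → ℕ), (u ∈ LRPencil.U Finset.univ ∧ LRPencil.canon Λ A Finset.univ ⊓ Module.End.maxGenEigenspace (L.B : V →ₗ[ℂ] V) (wt u) ≠ ⊥) → ∀ (s : ℕ), 1 ≤ s → s ≤ (LRPencil.supp u).card → ∃ v : Fin m → ℕ, v ≤ u ∧ (v ∈ LRPencil.U Finset.univ ∧ LRPencil.canon Λ A Finset.univ ⊓ Module.End.maxGenEigenspace (L.B :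 V →ₗ[ℂ] V) (wt v) ≠ ⊥) ∧ (LRPencil.supp v).card = s :=
  fun L wt hinj hstep hker u hu s hs1 hs => exists_good_of_le_card_of_le L wt hinj hstep hker _ u rfl hu s hs1 hs

end Summit.ValiantsHypothesis.ValiantsHypothesis.Theorems.ProjectionStabilityOptStep.GenTorus
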